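import Summits.ResolutionOfSingularities.ResolutionOfSingularities.Theorems.UniversalCellsCampaignW82ExponentZeroGraded
import Mathlib.Algebra.CharP.Frobenius
import HarnessLib

/-!
# [OURS · L1 W8.2] The BOUNDED-EXPONENT forms of the Frobenius-twist step of slot W8.2 — a UNIFORM bound `e₀` on
# the twist exponent («∃∀» instead of the residual's «∀∃»; `e₀ = 0` = the exponent-zero form) — campaign
# statements, Theses-free module

Cell `res-hironaka` (run/shared/lean/pub/res-hironaka/), LADDER-RESOLUTION rung L (RESCUE), slot W8.2 of
plan/RESCUE-SEED.md («PRIME-FIELD / UNIVERSALITY TRANSFER instead of descent»), host route `UniversalCells`, host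
item `PrimeFieldToPerfect` (stmt-ResolutionOfSingularities-15233); second door `UniformComplexity`
`PrimeModelTransfer` (stmt-ResolutionOfSingularities-8933) — the bounded forms are stated at an ARBITRARY constant
field `M` of characteristic `p`, so they serve both doors (door 2: `M` algebraically closed). Statement-only file
(typer res-L1-type-o6 for the two-lane OURS desk; sibling of res-L1-s82-pv-1's `…CampaignW82ExponentZeroGraded.lean`
— p502587: `HasSmoothProperBirationalModel`, `SmoothModelStepRegularAt`): one parametric
predicate, three pointwise OURS `Prop`s, pure-logic / transport anchors; NOTHING is proved about resolution of
singularities here and nothing is asserted.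

WHY THIS FILE. The residual of slot W8.2 in Frobenius-twist form (`FrobeniusTwistStepAt p M n` /
`FrobeniusTwistStepRegularAt p M n`, p485672) asks, for EACH `X₀`, for SOME exponent `e` («∀∃»). The natural
strengthening (s3) of Cruxes/PrimeFieldToPerfect/Disproof.lean §4 asks for ONE exponent `e₀` serving ALL `X₀` of the
grade («∃∀»), or at least for a BOUND `e ≤ e₀`. The W8.2 provers' negative side on this has LANDED, stated INLINE
(binder for binder the bodies below): res-L1-s82-pv-2's `TwistExponent.frobeniusTwist_exponent_unbounded` /
`TwistExponent.not_exists_uniform_frobeniusTwist_exponent` (p510058, Theorems/UniformComplexityCampaignW82TwistExponentUnbounded.lean: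
for every `e₀` the geometrically integral curve `y^q = x^{p^{e₀+1}} − t` over `M(t)` has a smooth proper birational
model of SOME Frobenius twist and of NO twist of level `≤ e₀`) and the REGULAR v2
`TwistExponent.frobeniusTwist_exponent_unbounded_regular` / `not_exists_uniform_frobeniusTwist_exponent_regular` with
the by-grade layer `not_boundedExponent_conclusion` · `boundedFrobeniusTwistStepRegularAt_iff_not_hyp` ·
`frobeniusTwistStepRegularAt_one_and_not_bounded` · `not_boundedFrobeniusTwistStepRegularAt_of_le_three` ·
`boundedFrobeniusTwistStepRegularAt_top_iff` (p513490, Theorems/UniformComplexityCampaignW82TwistExponentRegular.lean);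
the bound-`0` case is res-L1-s82-pv-1's `SmoothModelStepRegularAt` (p502587), refuted at grade `1` by
`not_smoothModelStepRegularAt_one` (p508560). THIS FILE gives the bounded predicate
`HasSmoothFrobeniusTwistModelLe p K f₀ e₀` (`∃ e ≤ e₀`) and the bounded / uniform steps NAMES — the body of
`FrobeniusTwistStepBoundedRegularAt p M n E` IS the left side of `boundedFrobeniusTwistStepRegularAt_iff_not_hyp`
(`frobeniusTwistStepBoundedRegularAt_iff`, `Iff.rfl`) — so that the negative side can be recorded BY NAME against
the positive rung `n ≤ 1` of the «∀∃» form (`frobeniusTwistStepAt_of_le_one` p483971,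
`frobeniusTwistStepRegularAt_of_le_one`). The by-name links are res-L1-s82-pv-2's (Links file announced on the
cell bus 2026-08-27T08:24:39Z), NOT proved here: this module imports no proof file and decides nothing.

CONTENT (non-embedded summit idiom; Mathlib `iterateFrobenius K p e`):

* `HasSmoothFrobeniusTwistModelLe p K f₀ e₀` — SOME twist `X₀ ×_{K,Frob^e} K` with `e ≤ e₀` has a proper birational
  model smooth over `K`; monotone in `e₀`; `e₀ = 0` ↔ `HasSmoothProperBirationalModel K f₀`
  (p502587; `hasSmoothFrobeniusTwistModelLe_zero_iff`, transport along `Spec (Frob^0) = 𝟙` both ways); the unbounded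
  predicate is the union over `e₀` (`hasSmoothFrobeniusTwistModel_iff_exists_le`).
* `FrobeniusTwistStepBoundedAt p M n e₀` / `FrobeniusTwistStepBoundedRegularAt p M n e₀` — the hypothesis block of
  `PerfectionStepAt M n` VERBATIM ⇒ every (regular) separated `X₀` of finite type, dimension `≤ n`,
  `IntegralOverPerfectClosure`, has `HasSmoothFrobeniusTwistModelLe p (RatFunc M) f₀ e₀`; bound `0` of the regular
  form ↔ pv-1's pinned step `SmoothModelStepRegularAt M n` (`frobeniusTwistStepBoundedRegularAt_zero_iff`).
* `FrobeniusTwistStepUniformAt p M n := ∃ e₀, FrobeniusTwistStepBoundedAt p M n e₀` — the «∃∀» form; its regular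
  sibling `FrobeniusTwistStepUniformRegularAt p M n := ∃ e₀, FrobeniusTwistStepBoundedRegularAt p M n e₀`.
* anchors: the transport along an ISOMORPHIC base change both ways (`exists_smoothModel_pullback_of_isIso`,
  `exists_smoothModel_of_pullback_of_isIso`; `isIso_specMap_iterateFrobenius_zero`), monotonicity in `e₀`,
  forgetting the bound / the regularity hypothesis, «∃∀ ⇒ ∀∃» (`frobeniusTwistStepAt_of_frobeniusTwistStepUniformAt`,
  `frobeniusTwistStepRegularAt_of_frobeniusTwistStepUniformRegularAt`), the inlined regular bounded step
  (`frobeniusTwistStepBoundedRegularAt_iff`, `Iff.rfl`).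

HONEST FRAMING. The `def`s below are OURS — campaign statements that REPLACE THE ROLE of §17 ¶2, p.89 l.59–62
read with §2 p.4 l.22–24 of H. Hironaka's manuscript *Resolution of singularities in positive characteristics*
(2017-03-23, [Hironaka2017]; typed AS PRINTED as `Literature.AlgebraicGeometry.Hironaka2017.S17Methodology.U89_3` /
`U89_3_ours`; locators as in the lane-signed p469608, layout lines p.89 L28–L31 / p.4 L21–L23): they name HOW MUCH
the finite level would have to supply uniformly, so that the failure of any uniform bound can be cited by name.
NOT statements of the manuscript; nothing attributed to its author; no typed candidate used even as a hypothesis.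
AI transcription, weaker than expert review; nothing here is progress on resolution of singularities in positive
characteristic; no claim beyond the kernel.

BUILD RULE (cell, director-resolution 2026-08-26T18:53:29Z (B)): OURS vocabulary file, THESES-FREE BY BIRTH —
imports only the Theses-free p502587 (`…CampaignW82ExponentZeroGraded`, cone p485672 / p481193 / p469608 / p475047),
`Mathlib.Algebra.CharP.Frobenius` (`iterateFrobenius_zero`) and `HarnessLib`.

BARRIERS (`Literature/Barriers/ResolutionOfSingularities/`): `RegularNotGeometricallyRegular.lean` (Kollár's curve)
and its higher-exponent relatives `y^q = x^{p^{e₀+1}} − t` are exactly the obstructions to every FIXED bound — the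
statements below are typed TO BE HIT by them; `FrobeniusTwistResolution.lean` motivates `IntegralOverPerfectClosure`
as in the siblings; `InseparableBaseChangeResolution.lean` is not crossed.

VACUITY SELF-CHECK: `HasSmoothFrobeniusTwistModelLe p K f₀ e₀` is true at every `e₀` when `f₀` is smooth, false at
every `e₀` for `X₀ = Spec 𝔽_p(t^{1/p})` over `𝔽_p(t)`; the steps (prime `p`) are trivially true at `n = ⊥`
(and true, though not proved here, at `n = 0`), never trivially false as typed (the hypothesis block follows from
`ResolutionInChar p`), monotone in `e₀`, NOT monotone in `n`; composite `p` cannot occur (`Fact p.Prime`).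

## References (vocabulary and locators only; nothing cited as a premise)
* H. Hironaka, ms. 2017-03-23, §17 ¶2 p.89 l.59–62; §2 p.4 l.22–24 — under adjudication, quoted for the
  role replaced, not asserted. [Hironaka2017]
* J. Kollár, *Lectures on Resolution of Singularities* (2007), 1.19 (curves over non-perfect fields) —
  context, not used. [Kollar2007]
* Cruxes/PrimeFieldToPerfect/Disproof.lean §4 (s3), KERNEL-c3.md §3; L/res-L1-s82-pv-2/DOOR2-KERNEL.md §4.5 — cell
  files, OURS.
-/

noncomputable section

set_option linter.dupNamespace false -- mandated namespace of this single-conjunct summit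

open _root_.CategoryTheory _root_.CategoryTheory.Limits _root_.AlgebraicGeometry
open Literature.AlgebraicGeometry.Resolution

namespace Summit.ResolutionOfSingularities.ResolutionOfSingularities.Theorems.CampaignW82

universe u

/-! ## A smooth model of a Frobenius twist of BOUNDED exponent -/

/-- [OURS · L1 W8.2] replaces the role of §17 ¶2, p.89 l.59–62 read with §2 p.4 l.22–24 («a perfect base field
K»; typed as `S17Methodology.U89_3_ours`) by naming a BOUND on what the finite level must supply; NOT a statement
of the manuscript. A SMOOTH MODEL OF A FROBENIUS TWIST OF EXPONENT AT MOST `e₀`: for SOME `e ≤ e₀` the twist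
`X₀ ×_{K,Frob^e} Spec K` has a proper birational model smooth over `K` — the predicate
`HasSmoothFrobeniusTwistModel p K f₀` (p485672) with the existential exponent BOUNDED by `e₀`. Monotone in `e₀`
(`hasSmoothFrobeniusTwistModelLe_mono`); implies the unbounded predicate (`hasSmoothFrobeniusTwistModel_of_le`);
at `e₀ = 0` it is `HasSmoothProperBirationalModel K f₀` (`hasSmoothFrobeniusTwistModelLe_zero_iff`). Vacuity: as for
`HasSmoothFrobeniusTwistModel` (false for `Spec 𝔽_p(t^{1/p})` over `𝔽_p(t)` at every `e₀`; true at every `e₀` when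
`f₀` is smooth); for the curve `y^q = x^{p^{e₀+1}} − t` over `M(t)` it fails at bound `e₀` and holds at bound `e₀ + 1`
(res-L1-s82-pv-2's inline `TwistExponent.frobeniusTwist_exponent_unbounded` p510058 / `…_regular` p513490; nothing
of this is decided in this file). [folklore] -/
def HasSmoothFrobeniusTwistModelLe (p : ℕ) (K : Type u) [Field K] [ExpChar K p] {X₀ : Scheme.{u}}
    (f₀ : X₀ ⟶ Spec (.of K)) (e₀ : ℕ) : Prop :=
  ∃ e ≤ e₀, ∃ (Y : Scheme.{u})
    (π : Y ⟶ pullback f₀ (Spec.map (CommRingCat.ofHom (iterateFrobenius K p e)))),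
    IsProper π ∧ IsBirational π ∧
      Smooth (π ≫ pullback.snd f₀ (Spec.map (CommRingCat.ofHom (iterateFrobenius K p e))))

/-- [OURS · L1 W8.2] replaces the role of §17 ¶2, p.89 l.59–62 read with §2 p.4 l.22–24 («a perfect base field
K»; typed as `S17Methodology.U89_3_ours`) at transcendence degree one, OVER THE SINGLE FIELD `RatFunc M`, with a
UNIFORM BOUND `e₀` on the Frobenius-twist exponent; NOT a statement of the manuscript. THE BOUNDED-EXPONENT STEP
at `M` (characteristic `p`), grade `n`, bound `e₀`: under the hypothesis block of `PerfectionStepAt M n`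
(verbatim), every separated `f₀ : X₀ ⟶ Spec (RatFunc M)` of finite type with `topologicalKrullDim X₀ ≤ n` and
`IntegralOverPerfectClosure (RatFunc M) f₀` has `HasSmoothFrobeniusTwistModelLe p (RatFunc M) f₀ e₀` — ONE exponent
`e₀` serving ALL such `X₀` (the «∃∀» strengthening (s3) of Cruxes/PrimeFieldToPerfect/Disproof.lean §4 of the
residual's «∀∃»). Monotone in `e₀`; at `e₀ = 0` its conclusion is `HasSmoothProperBirationalModel` (p502587) for every `X₀`;
every bound implies `FrobeniusTwistStepAt p M n` (`frobeniusTwistStepAt_of_frobeniusTwistStepBoundedAt`). Status by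
the provers' theorems (inline, not linked here): its conclusion block is refuted for every `e₀`, every grade
`n ≥ 1` and every `M` of characteristic `p` — even with `Scheme.IsRegular X₀` added — by res-L1-s82-pv-2's
`TwistExponent.not_boundedExponent_conclusion` (p513490), so at `n = 1`, where the hypothesis block holds
(`Resolution.hasResolution_of_dim_le_one`), the step fails for every `e₀`; the by-name link is pv-2's Links file,
not this one. Vacuity (prime `p`): trivially true at `n = ⊥`, and true — though not proved here — at `n = 0`
(a geometrically reduced point of finite type over a field is étale); for `n ≥ 1` it holds exactly when its
hypothesis block fails (pv-2's reading); NOT monotone in `n`. [folklore] -/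
def FrobeniusTwistStepBoundedAt (p : ℕ) [Fact p.Prime] (M : Type) [Field M] [CharP M p] (n : WithBot ℕ∞)
    (e₀ : ℕ) : Prop :=
  (∀ (X : Scheme.{0}) (f : X ⟶ Spec (.of (RatFunc M))),
      IsSeparated f → LocallyOfFiniteType f → QuasiCompact f → IsIntegral X →
        topologicalKrullDim X ≤ n → Scheme.HasResolution X) →
    ∀ (X₀ : Scheme.{0}) (f₀ : X₀ ⟶ Spec (.of (RatFunc M))),
      IsSeparated f₀ → LocallyOfFiniteType f₀ → QuasiCompact f₀ → topologicalKrullDim X₀ ≤ n →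
        IntegralOverPerfectClosure (RatFunc M) f₀ → HasSmoothFrobeniusTwistModelLe p (RatFunc M) f₀ e₀

/-- [OURS · L1 W8.2] replaces the role of §17 ¶2, p.89 l.59–62 read with §2 p.4 l.22–24 («a perfect base field
K»; typed as `S17Methodology.U89_3_ours`) at transcendence degree one, OVER THE SINGLE FIELD `RatFunc M`, for
REGULAR varieties only, with a UNIFORM BOUND `e₀` on the twist exponent; NOT a statement of the manuscript. THE
BOUNDED-EXPONENT STEP FOR REGULAR VARIETIES at `M` (characteristic `p`), grade `n`, bound `e₀`: as
`FrobeniusTwistStepBoundedAt p M n e₀` with the extra hypothesis `Scheme.IsRegular X₀` — «some Frobenius twist of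
exponent `≤ e₀` of every regular irreducible geometrically reduced variety of dimension `≤ n` over `M(t)` has a
smooth proper birational model over `M(t)`». Implied by the full bounded step
(`frobeniusTwistStepBoundedRegularAt_of_frobeniusTwistStepBoundedAt`); `e₀ = 0` is `SmoothModelStepRegularAt M n` (p502587)
(`frobeniusTwistStepBoundedRegularAt_zero_iff`); implies `FrobeniusTwistStepRegularAt p M n`. Its body is, binder
for binder, the left side of res-L1-s82-pv-2's `TwistExponent.boundedFrobeniusTwistStepRegularAt_iff_not_hyp`
(p513490; `frobeniusTwistStepBoundedRegularAt_iff` below, `Iff.rfl`): by that theorem it holds for `n ≥ 1` iff its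
hypothesis block FAILS, and at `n = 1` it fails for every `e₀` while the unbounded `FrobeniusTwistStepRegularAt p M 1`
holds (`TwistExponent.frobeniusTwistStepRegularAt_one_and_not_bounded`; witness the REGULAR curves
`y^q = x^{p^{e₀+1}} − t`); the by-name link is pv-2's Links file, not this one. Vacuity (prime `p`): trivially
true at `n = ⊥`, and true — though not proved here — at `n = 0`; NOT monotone in `n`. [folklore] -/
def FrobeniusTwistStepBoundedRegularAt (p : ℕ) [Fact p.Prime] (M : Type) [Field M] [CharP M p]
    (n : WithBot ℕ∞) (e₀ : ℕ) : Prop :=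
  (∀ (X : Scheme.{0}) (f : X ⟶ Spec (.of (RatFunc M))),
      IsSeparated f → LocallyOfFiniteType f → QuasiCompact f → IsIntegral X →
        topologicalKrullDim X ≤ n → Scheme.HasResolution X) →
    ∀ (X₀ : Scheme.{0}) (f₀ : X₀ ⟶ Spec (.of (RatFunc M))),
      IsSeparated f₀ → LocallyOfFiniteType f₀ → QuasiCompact f₀ → topologicalKrullDim X₀ ≤ n →
        IntegralOverPerfectClosure (RatFunc M) f₀ → Scheme.IsRegular X₀ →
          HasSmoothFrobeniusTwistModelLe p (RatFunc M) f₀ e₀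

/-- [OURS · L1 W8.2] replaces the role of §17 ¶2, p.89 l.59–62 read with §2 p.4 l.22–24 («a perfect base field
K»; typed as `S17Methodology.U89_3_ours`) at transcendence degree one over `RatFunc M`, asking for SOME UNIFORM
twist exponent; NOT a statement of the manuscript. THE UNIFORM-EXPONENT STEP at `M` (characteristic `p`), grade
`n`: `∃ e₀, FrobeniusTwistStepBoundedAt p M n e₀` — the «∃∀» strengthening (s3) of the residual
`FrobeniusTwistStepAt p M n` («∀∃»), which it implies (`frobeniusTwistStepAt_of_frobeniusTwistStepUniformAt`).
Status by the provers' theorems (inline, not linked here): refuted at `n = 1` for every `M` of characteristic `p`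
via res-L1-s82-pv-2's `TwistExponent.not_exists_uniform_frobeniusTwist_exponent` (p510058); for `n ≥ 1` it holds
exactly when the hypothesis block fails. Vacuity (prime `p`): trivially true at `n = ⊥`, and true — though not
proved here — at `n = 0` (a geometrically reduced point of finite type over a field is étale); NOT monotone in
`n`. [folklore] -/
def FrobeniusTwistStepUniformAt (p : ℕ) [Fact p.Prime] (M : Type) [Field M] [CharP M p]
    (n : WithBot ℕ∞) : Prop :=
  ∃ e₀ : ℕ, FrobeniusTwistStepBoundedAt p M n e₀

/-- [OURS · L1 W8.2] replaces the role of §17 ¶2, p.89 l.59–62 read with §2 p.4 l.22–24 («a perfect base field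
K»; typed as `S17Methodology.U89_3_ours`) at transcendence degree one over `RatFunc M`, for REGULAR varieties only,
asking for SOME UNIFORM twist exponent; NOT a statement of the manuscript. THE UNIFORM-EXPONENT STEP FOR REGULAR
VARIETIES at `M` (characteristic `p`), grade `n`: `∃ e₀, FrobeniusTwistStepBoundedRegularAt p M n e₀` — the «∃∀»
strengthening of `FrobeniusTwistStepRegularAt p M n`, which it implies
(`frobeniusTwistStepRegularAt_of_frobeniusTwistStepUniformRegularAt`); implied by `FrobeniusTwistStepUniformAt p M n`
(`frobeniusTwistStepUniformRegularAt_of_frobeniusTwistStepUniformAt`). Status by the provers' theorems (inline, not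
linked here): refuted at `n = 1` for every `M` of characteristic `p` via res-L1-s82-pv-2's
`TwistExponent.not_exists_uniform_frobeniusTwist_exponent_regular` (p513490: «no uniform exponent EVEN AMONG REGULAR
`X₀`»); for `n ≥ 1` it holds exactly when the hypothesis block fails. Vacuity (prime `p`): trivially true at
`n = ⊥`, and true — though not proved here — at `n = 0`; NOT monotone in `n`. [folklore] -/
def FrobeniusTwistStepUniformRegularAt (p : ℕ) [Fact p.Prime] (M : Type) [Field M] [CharP M p]
    (n : WithBot ℕ∞) : Prop :=
  ∃ e₀ : ℕ, FrobeniusTwistStepBoundedRegularAt p M n e₀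

/-! ## Anchors for the bounded forms -/

/-- **The bounded predicate, inlined** (definitional, `Iff.rfl`). [folklore] -/
theorem hasSmoothFrobeniusTwistModelLe_iff (p : ℕ) (K : Type u) [Field K] [ExpChar K p] {X₀ : Scheme.{u}}
    (f₀ : X₀ ⟶ Spec (.of K)) (e₀ : ℕ) :
    HasSmoothFrobeniusTwistModelLe p K f₀ e₀ ↔
      ∃ e ≤ e₀, ∃ (Y : Scheme.{u})
        (π : Y ⟶ pullback f₀ (Spec.map (CommRingCat.ofHom (iterateFrobenius K p e)))),
        IsProper π ∧ IsBirational π ∧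
          Smooth (π ≫ pullback.snd f₀ (Spec.map (CommRingCat.ofHom (iterateFrobenius K p e)))) :=
  Iff.rfl

/-- **Monotonicity in the bound.** [folklore] -/
theorem hasSmoothFrobeniusTwistModelLe_mono (p : ℕ) (K : Type u) [Field K] [ExpChar K p] {X₀ : Scheme.{u}}
    (f₀ : X₀ ⟶ Spec (.of K)) {e₀ e₁ : ℕ} (hle : e₀ ≤ e₁)
    (h : HasSmoothFrobeniusTwistModelLe p K f₀ e₀) :
    HasSmoothFrobeniusTwistModelLe p K f₀ e₁ := by
  obtain ⟨e, he, Y, π, h₁, h₂, h₃⟩ := h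
  exact ⟨e, he.trans hle, Y, π, h₁, h₂, h₃⟩

/-- **A bounded twist exponent is a twist exponent** (forget the bound). [folklore] -/
theorem hasSmoothFrobeniusTwistModel_of_le (p : ℕ) (K : Type u) [Field K] [ExpChar K p] {X₀ : Scheme.{u}}
    (f₀ : X₀ ⟶ Spec (.of K)) {e₀ : ℕ} (h : HasSmoothFrobeniusTwistModelLe p K f₀ e₀) :
    HasSmoothFrobeniusTwistModel p K f₀ := by
  obtain ⟨e, _, Y, π, h₁, h₂, h₃⟩ := h
  exact ⟨e, Y, π, h₁, h₂, h₃⟩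

/-- **The unbounded predicate is the union of the bounded ones.** [folklore] -/
theorem hasSmoothFrobeniusTwistModel_iff_exists_le (p : ℕ) (K : Type u) [Field K] [ExpChar K p]
    {X₀ : Scheme.{u}} (f₀ : X₀ ⟶ Spec (.of K)) :
    HasSmoothFrobeniusTwistModel p K f₀ ↔ ∃ e₀, HasSmoothFrobeniusTwistModelLe p K f₀ e₀ :=
  ⟨fun ⟨e, Y, π, h₁, h₂, h₃⟩ => ⟨e, e, le_rfl, Y, π, h₁, h₂, h₃⟩,
    fun ⟨_, h⟩ => hasSmoothFrobeniusTwistModel_of_le p K f₀ h⟩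

/-- **Transport of a smooth model along an ISOMORPHIC base change.** If `g : S ⟶ Spec K` is an isomorphism and
`π : Y ⟶ X₀` is proper birational with `π ≫ f₀` smooth, then `π ≫ (pullback.fst f₀ g)⁻¹ : Y ⟶ X₀ ×_{Spec K} S` is
proper birational with smooth composite to `S` (`pullback.fst` is an isomorphism; `IsProper` respects
isomorphisms, tree `IsBirational.comp_iso`, and `(pullback.fst)⁻¹ ≫ pullback.snd = f₀ ≫ g⁻¹`). [folklore] -/
theorem exists_smoothModel_pullback_of_isIso {K : Type u} [Field K] {X₀ Y S : Scheme.{u}}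
    (f₀ : X₀ ⟶ Spec (.of K)) (g : S ⟶ Spec (.of K)) [IsIso g] (π : Y ⟶ X₀) [IsProper π]
    (hbir : IsBirational π) [Smooth (π ≫ f₀)] :
    ∃ π' : Y ⟶ pullback f₀ g, IsProper π' ∧ IsBirational π' ∧ Smooth (π' ≫ pullback.snd f₀ g) := by
  refine ⟨π ≫ inv (pullback.fst f₀ g), ?_, hbir.comp_iso _, ?_⟩
  · exact (MorphismProperty.cancel_right_of_respectsIso @IsProper _ _).mpr ‹IsProper π›
  · have h : inv (pullback.fst f₀ g) ≫ pullback.snd f₀ g = f₀ ≫ inv g := by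
      rw [IsIso.inv_comp_eq, ← Category.assoc, IsIso.eq_comp_inv]
      exact pullback.condition.symm
    rw [Category.assoc, h, ← Category.assoc]
    infer_instance

/-- `Spec (Frob^0)` is an isomorphism (`Frob^0 = id`, Mathlib `iterateFrobenius_zero`). [folklore] -/
theorem isIso_specMap_iterateFrobenius_zero (p : ℕ) (K : Type u) [Field K] [ExpChar K p] :
    IsIso (Spec.map (CommRingCat.ofHom (iterateFrobenius K p 0))) := by
  rw [iterateFrobenius_zero, CommRingCat.ofHom_id, Spec.map_id]
  infer_instance

/-- **Transport BACK along an isomorphic base change**: a proper birational `π' : Y ⟶ X₀ ×_{Spec K} S` with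
smooth composite to `S`, `g : S ⟶ Spec K` an isomorphism, gives the proper birational `π' ≫ pullback.fst : Y ⟶ X₀`
with `Y ⟶ Spec K` smooth (`pullback.fst ≫ f₀ = pullback.snd ≫ g`). [folklore] -/
theorem exists_smoothModel_of_pullback_of_isIso {K : Type u} [Field K] {X₀ Y S : Scheme.{u}}
    (f₀ : X₀ ⟶ Spec (.of K)) (g : S ⟶ Spec (.of K)) [IsIso g] (π' : Y ⟶ pullback f₀ g) [IsProper π']
    (hbir : IsBirational π') [Smooth (π' ≫ pullback.snd f₀ g)] :
    ∃ π : Y ⟶ X₀, IsProper π ∧ IsBirational π ∧ Smooth (π ≫ f₀) := by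
  refine ⟨π' ≫ pullback.fst f₀ g, ?_, hbir.comp_iso _, ?_⟩
  · exact (MorphismProperty.cancel_right_of_respectsIso @IsProper _ _).mpr ‹IsProper π'›
  · rw [Category.assoc, pullback.condition, ← Category.assoc]
    infer_instance

/-- **Bound `0` is the exponent-zero form** (transport along `Spec (Frob^0) = 𝟙` both ways). [folklore] -/
theorem hasSmoothFrobeniusTwistModelLe_zero_iff (p : ℕ) (K : Type u) [Field K] [ExpChar K p]
    {X₀ : Scheme.{u}} (f₀ : X₀ ⟶ Spec (.of K)) :
    HasSmoothFrobeniusTwistModelLe p K f₀ 0 ↔ HasSmoothProperBirationalModel K f₀ := by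
  haveI := isIso_specMap_iterateFrobenius_zero p K
  constructor
  · rintro ⟨e, he, Y, π', hprop, hbir, hsm⟩
    obtain rfl : e = 0 := Nat.le_zero.mp he
    haveI := hprop
    haveI := hsm
    obtain ⟨π, h₁, h₂, h₃⟩ :=
      exists_smoothModel_of_pullback_of_isIso f₀ (Spec.map (CommRingCat.ofHom (iterateFrobenius K p 0))) π' hbir
    exact ⟨Y, π, h₁, h₂, h₃⟩
  · rintro ⟨Y, π, hprop, hbir, hsm⟩
    haveI := hprop
    haveI := hsm
    obtain ⟨π', h₁, h₂, h₃⟩ :=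
      exists_smoothModel_pullback_of_isIso f₀ (Spec.map (CommRingCat.ofHom (iterateFrobenius K p 0))) π hbir
    exact ⟨0, le_rfl, Y, π', h₁, h₂, h₃⟩

/-- **Monotonicity of the bounded step in the bound.** [folklore] -/
theorem frobeniusTwistStepBoundedAt_mono {p : ℕ} [Fact p.Prime] {M : Type} [Field M] [CharP M p]
    {n : WithBot ℕ∞} {e₀ e₁ : ℕ} (hle : e₀ ≤ e₁) (h : FrobeniusTwistStepBoundedAt p M n e₀) :
    FrobeniusTwistStepBoundedAt p M n e₁ :=
  fun hM X₀ f₀ hs hl hq hd hint =>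
    hasSmoothFrobeniusTwistModelLe_mono p (RatFunc M) f₀ hle (h hM X₀ f₀ hs hl hq hd hint)

/-- **The regular bounded form is implied by the full bounded form** (forget regularity). [folklore] -/
theorem frobeniusTwistStepBoundedRegularAt_of_frobeniusTwistStepBoundedAt {p : ℕ} [Fact p.Prime] {M : Type}
    [Field M] [CharP M p] {n : WithBot ℕ∞} {e₀ : ℕ} (h : FrobeniusTwistStepBoundedAt p M n e₀) :
    FrobeniusTwistStepBoundedRegularAt p M n e₀ :=
  fun hM X₀ f₀ hs hl hq hd hint _ => h hM X₀ f₀ hs hl hq hd hint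

/-- **Bound `0` of the regular step is the regular exponent-zero step.** [folklore] -/
theorem frobeniusTwistStepBoundedRegularAt_zero_iff {p : ℕ} [Fact p.Prime] {M : Type} [Field M] [CharP M p]
    {n : WithBot ℕ∞} : FrobeniusTwistStepBoundedRegularAt p M n 0 ↔ SmoothModelStepRegularAt M n :=
  ⟨fun h hM X₀ f₀ hs hl hq hd hint hreg =>
      (hasSmoothFrobeniusTwistModelLe_zero_iff p (RatFunc M) f₀).mp (h hM X₀ f₀ hs hl hq hd hint hreg),
    fun h hM X₀ f₀ hs hl hq hd hint hreg =>
      (hasSmoothFrobeniusTwistModelLe_zero_iff p (RatFunc M) f₀).mpr (h hM X₀ f₀ hs hl hq hd hint hreg)⟩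

/-- **Every bound implies the (unbounded) Frobenius-twist step.** [folklore] -/
theorem frobeniusTwistStepAt_of_frobeniusTwistStepBoundedAt {p : ℕ} [Fact p.Prime] {M : Type} [Field M]
    [CharP M p] {n : WithBot ℕ∞} {e₀ : ℕ} (h : FrobeniusTwistStepBoundedAt p M n e₀) :
    FrobeniusTwistStepAt p M n :=
  fun hM X₀ f₀ hs hl hq hd hint =>
    hasSmoothFrobeniusTwistModel_of_le p (RatFunc M) f₀ (h hM X₀ f₀ hs hl hq hd hint)

/-- **Every bound (regular form) implies the regular Frobenius-twist step.** [folklore] -/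
theorem frobeniusTwistStepRegularAt_of_frobeniusTwistStepBoundedRegularAt {p : ℕ} [Fact p.Prime] {M : Type}
    [Field M] [CharP M p] {n : WithBot ℕ∞} {e₀ : ℕ} (h : FrobeniusTwistStepBoundedRegularAt p M n e₀) :
    FrobeniusTwistStepRegularAt p M n :=
  fun hM X₀ f₀ hs hl hq hd hint hreg =>
    hasSmoothFrobeniusTwistModel_of_le p (RatFunc M) f₀ (h hM X₀ f₀ hs hl hq hd hint hreg)

/-- **A uniform exponent implies the Frobenius-twist step** («∃∀ ⇒ ∀∃»). [folklore] -/
theorem frobeniusTwistStepAt_of_frobeniusTwistStepUniformAt {p : ℕ} [Fact p.Prime] {M : Type} [Field M]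
    [CharP M p] {n : WithBot ℕ∞} (h : FrobeniusTwistStepUniformAt p M n) : FrobeniusTwistStepAt p M n := by
  obtain ⟨e₀, h⟩ := h
  exact frobeniusTwistStepAt_of_frobeniusTwistStepBoundedAt h

/-- **Monotonicity of the regular bounded step in the bound.** [folklore] -/
theorem frobeniusTwistStepBoundedRegularAt_mono {p : ℕ} [Fact p.Prime] {M : Type} [Field M] [CharP M p]
    {n : WithBot ℕ∞} {e₀ e₁ : ℕ} (hle : e₀ ≤ e₁) (h : FrobeniusTwistStepBoundedRegularAt p M n e₀) :
    FrobeniusTwistStepBoundedRegularAt p M n e₁ :=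
  fun hM X₀ f₀ hs hl hq hd hint hreg =>
    hasSmoothFrobeniusTwistModelLe_mono p (RatFunc M) f₀ hle (h hM X₀ f₀ hs hl hq hd hint hreg)

/-- **A uniform exponent is a uniform exponent for regular varieties** (forget regularity). [folklore] -/
theorem frobeniusTwistStepUniformRegularAt_of_frobeniusTwistStepUniformAt {p : ℕ} [Fact p.Prime] {M : Type}
    [Field M] [CharP M p] {n : WithBot ℕ∞} (h : FrobeniusTwistStepUniformAt p M n) :
    FrobeniusTwistStepUniformRegularAt p M n := by
  obtain ⟨e₀, h⟩ := h
  exact ⟨e₀, frobeniusTwistStepBoundedRegularAt_of_frobeniusTwistStepBoundedAt h⟩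

/-- **A uniform exponent for regular varieties implies the regular Frobenius-twist step** («∃∀ ⇒ ∀∃»).
[folklore] -/
theorem frobeniusTwistStepRegularAt_of_frobeniusTwistStepUniformRegularAt {p : ℕ} [Fact p.Prime] {M : Type}
    [Field M] [CharP M p] {n : WithBot ℕ∞} (h : FrobeniusTwistStepUniformRegularAt p M n) :
    FrobeniusTwistStepRegularAt p M n := by
  obtain ⟨e₀, h⟩ := h
  exact frobeniusTwistStepRegularAt_of_frobeniusTwistStepBoundedRegularAt h

/-- **The regular bounded step, inlined** (definitional, `Iff.rfl`): binder for binder the left side of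
res-L1-s82-pv-2's `TwistExponent.boundedFrobeniusTwistStepRegularAt_iff_not_hyp` (p513490). [folklore] -/
theorem frobeniusTwistStepBoundedRegularAt_iff (p : ℕ) [Fact p.Prime] (M : Type) [Field M] [CharP M p]
    (n : WithBot ℕ∞) (e₀ : ℕ) :
    FrobeniusTwistStepBoundedRegularAt p M n e₀ ↔
      ((∀ (X : Scheme.{0}) (f : X ⟶ Spec (.of (RatFunc M))),
          IsSeparated f → LocallyOfFiniteType f → QuasiCompact f → IsIntegral X →
            topologicalKrullDim X ≤ n → Scheme.HasResolution X) →
        ∀ (X₀ : Scheme.{0}) (f₀ : X₀ ⟶ Spec (.of (RatFunc M))),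
          IsSeparated f₀ → LocallyOfFiniteType f₀ → QuasiCompact f₀ → topologicalKrullDim X₀ ≤ n →
            IntegralOverPerfectClosure (RatFunc M) f₀ → Scheme.IsRegular X₀ →
            ∃ e ≤ e₀, ∃ (Y : Scheme.{0})
              (π : Y ⟶ pullback f₀ (Spec.map (CommRingCat.ofHom (iterateFrobenius (RatFunc M) p e)))),
              IsProper π ∧ IsBirational π ∧
                Smooth (π ≫ pullback.snd f₀ (Spec.map (CommRingCat.ofHom (iterateFrobenius (RatFunc M) p e))))) :=
  Iff.rfl

end Summit.ResolutionOfSingularities.ResolutionOfSingularities.Theorems.CampaignW82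

end
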